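import Summits.QuantumFields.BalabanUV.T4Continuum.Support.NE7CubeLandauReg910
import Summits.QuantumFields.BalabanUV.T4Continuum.Support.NE7CubeLandauChart
import Summits.QuantumFields.BalabanUV.T4Continuum.Support.NE7Reg10ImpliesReg9
import Summits.QuantumFields.BalabanUV.T4Continuum.Support.NE7AllMinimisersRegularSpaceGeneric
import HarnessLib

/-!
# NE7AllMinimisersCubeReg910 — [Balaban1985Variational] THM 1 (9)₂, (10) AND (9)₃ FOR EVERY `β < 1`, FOR EVERY CONSTRAINED SMALL-FIELD MINIMISER, ON THE PHYSICAL UNIT CUBE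
# ABOUT EVERY POINT, `k`-UNIFORMLY, WITH NO DISPLAYED LETTER: around every `z` there is a unitary gauge `u` and a skew potential `A` with `U^{u} = e^{A}` on the cube of
# lattice radius `16M + 5` (`M = L^k`) such that `‖A‖ ≤ C₀ε∕M` ((9)₁), `‖∇A‖ ≤ C₁ε∕M²` for `|x − z|_∞ ≤ 8M` ((9)₂), `‖ΔA‖ ≤ C₂ε∕M³` for `|y − z|_∞ ≤ 7M` ((10)), and
# `‖∇A(z₁) − ∇A(z₂)‖ ≤ C₃(1 + (1−β)⁻¹)·ε·h^β∕M^{2+β}` for `z₁, z₂ ∈ cube z (M − 1)`, `h = |z₁ − z₂|_∞ ≤ 2M − 2` ((9)₃) — `C₀, …, C₃` depending on `L` and `card n` ONLY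
# (file G3b of gen 112 = the docking of the BOX ROUTE: gen 93's one-scale Uhlenbeck chart + G3a + gen 111's (1.7)∕(1.9)-type letters ✓ p814818)

Cell `pub-balaban`, rung (B)+1 sub-cell t4, lineage `b2b-balaban-t4-ne7-p1` (CRUX PROVER NE7 #1 = OWNER of BINDER row NE7), generation 112.  Memo
`t4/b2b-balaban-t4-ne7-p1-g112/ROAD-G112.md` §5–§6.  BY NAME over gen 93's `NE7CubeLandauChart.cube_landau_chart` (the ONE-SCALE LATTICE UHLENBECK LEMMA: a free-boundary Landau
gauge on the cube of radius `R` about `z` with `‖A‖ ≤ 128·4³(2R+3)ε′`, the lattice Landau condition at every site of the cube; regime `(2R+3)²ε′ ≪ 1`), G3a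
`NE7CubeLandauReg910.cube_landau_reg910`, F4 `NE7Reg10ImpliesReg9.rpow_scaling`, and ✓ p814818 `NE7AllMinimisersRegularSpaceGeneric.all_minimisers_regularSpace_generic`
(`SmallField U (ε∕M²)` and the LOG-FREE current `‖covDiv 1 U‖ ≤ C_J ε∕M³` of every minimiser).
WHAT IS PROVED (**`all_minimisers_cube_reg910`**, `d = 4`, every `U(n)`, every `L ≥ 2`; 0 def, 0 sorry): the statement in the title, quantified as the row's theorems of record
(`∃ C₀ C₁ C₂ C₃ ≥ 0, ∃ ε₀ > 0, ∀ 0 < ε ≤ ε₀, ∀ N ≥ 1, ∃ δ_V > 0, ∀ V` unitary `N`-periodic `SmallField V δ_V`, `∀ k U, IsMinimiser 4 (sfClass 4 L N ε) L N k V U → ∀ z, ∃ u A, …`).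
THE MECHANISM.  `R = 16M + 5`, `ε′ = 2ε∕M²` (chart regime `regime_chart`: `(2R+3) ≤ 45M`, `π ≤ 4`, `10¹⁶·(card n + 1)(C_J + 1)·ε ≤ 1`), `a₀ ≤ 737280·ε∕M`; the chart's `W − Wᴴ`
Landau condition is the `sinh` condition on the cube of radius `16M + 4` (skewness: `(e^{A})ᴴ = e^{−A}`); `W = U^{u}` has `SmallField W (ε∕M²)` and `‖covDiv 1 W‖ = ‖covDiv 1 U‖`
(gauge invariance); G3a at `R₀ = 16M`, `R₁ = 7M`, `m = M` with `144·4·a₀·R₀ ≤ 1`; the raw bounds `G₁ = 36d·a₀∕R₀ + 4R₀j_ε`, `Λ = j_ε + θG₁` are `≤ C₁ε∕M²`, `≤ C₂ε∕M³`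
(`bound_jε`, `bound_G₁`, `bound_Λ`), and `(Λ + a₀∕M²)(3M)^{1−β} ≤ 3(C₂ + C₀)ε∕M^{2+β}` (`rpow_scaling`).
WHAT IT IS ∕ IS NOT.  IS: print's regularity clauses (9) (all three, the Hölder one for every `β < 1`) and the Laplacian clause of (10), for OUR constrained minimisers (B11 (8) with
`sfClass`), at their own scale, over the full physical range, uniformly in `k` — by OUR route (axial∕comb start, gen 93's lattice Uhlenbeck gauge by incremental minimisation, the
current from the class + interiority + criticality (gen 109∕111), the weighted interior bootstrap, flat lattice potential theory).  IS NOT: `β = 1` (FALSE in kind for block-rough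
data: the junction logarithm, ROAD-G110 §4 kit j342950 — print's `β₀ = 1` is NOT reached and presumably not reachable at one scale); the `∂^{η*}∂^ηA` clause of (10) separately (it is
`ΔA − ∂(∂*A)` with `∂*A = O(a₀²G)` here — recorded, not filed); Bałaban's minimisers∕method; NE7 as a spine node; spine 0∕9; finite T⁴ rung (B)+1 — NOT infinite volume, NOT mass gap,
NOT BetaPertH, NOT Clay (continuum YM on T⁴ ⇐ BetaPertH ∧ nine spine estimates).
-/

set_option autoImplicit false

open NormedSpace
open scoped BigOperators Matrix Matrix.Norms.L2Operator
open Finset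

namespace Summit.QuantumFields.BalabanUV.T4Continuum.NE7AllMinimisersCubeReg910

open Literature.MathematicalPhysics.QuantumFieldTheory.Balaban1983to89
open B7Prop1Explicit B7Prop2Explicit
open B8Ineq132 (covDiv norm_covDiv_gaugeAct)
open T4AveragingDeficitWall (SmallField IsUnitaryCfg)
open T4AveragingDeficitWallBoundary (IsPeriodicCfg)
open AveragingDeficitTransport (mem_U1_of_unitary)
open BlockAverageCurrent (smallField_gaugeAct)
open Beta.PoissonInterior (cube mem_cube mem_cube_iff_supNorm supNorm)
open MinimalActionSandwich (IsMinimiser admissible)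
open MinimalActionRate (sfClass)
open NE7CubeLandauChart (cube_landau_chart)
open NE7CubeLandauReg910 (cube_landau_reg910)
open NE7Reg10ImpliesReg9 (rpow_scaling)
open NE7AllMinimisersRegularSpaceGeneric (all_minimisers_regularSpace_generic)

noncomputable section

/-! ## §1 Real arithmetic: the chart regime and the three raw bounds -/

section Arith

/-- `e^{t} − 1 ≤ 2t` for `0 ≤ t ≤ 1`. [folklore] -/
private theorem exp_sub_one_le (t : ℝ) (h0 : 0 ≤ t) (h1 : t ≤ 1) : Real.exp t - 1 ≤ 2 * t := by
  have h' := Real.abs_exp_sub_one_le (x := t) (by rw [abs_of_nonneg h0]; exact h1)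
  rw [abs_of_nonneg h0] at h'
  exact (le_abs_self _).trans h'

/-- **THE CHART REGIME** at radius `R` with `X = 2R+3 ≤ 45M`, `X₂ = 2R+2 ≤ 45M`, `η = ε∕M²`, `ε′ = 2η`, under `10¹⁶·c·ε ≤ 1` (`c ≥ 1`; in use `c = (card n + 1)(C_J + 1)`):
the three hypotheses of `cube_landau_chart` and the sup currency `128·4³·X·ε′ ≤ 737280·ε∕M`. [folklore] -/
theorem regime_chart {M ε c cn X X₂ : ℝ} (hM : 1 ≤ M) (hε : 0 < ε) (hc : 1 ≤ c) (hcn1 : 1 ≤ cn) (hcnc : cn ≤ c) (hsmall : 10 ^ 16 * c * ε ≤ 1)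
    (hX : X ≤ 45 * M) (hX1 : 1 ≤ X) (hX₂ : X₂ ≤ 45 * M) (hX₂0 : 0 ≤ X₂) :
    ε / M ^ 2 + 8 * (Real.pi / 2 * (3 * X₂ * (ε / M ^ 2))) * (Real.exp (4 * (Real.pi / 2 * (3 * X₂ * (ε / M ^ 2)))) - 1) ≤ 2 * (ε / M ^ 2) ∧
    576 * (64 * ((4 : ℕ) : ℝ) ^ 3 * X) ^ 2 * (2 * (ε / M ^ 2)) ≤ 1 ∧
    cn * (1 + 2 * ((4 : ℕ) : ℝ) * X) * (256 * ((4 : ℕ) : ℝ) ^ 3 * X * (2 * (ε / M ^ 2))) ≤ 1 / 2 ∧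
    128 * ((4 : ℕ) : ℝ) ^ 3 * X * (2 * (ε / M ^ 2)) ≤ 737280 * ε / M := by
  have hM0 : 0 < M := by linarith
  have hM2 : 0 < M ^ 2 := by positivity
  have hεc : ε ≤ 1 / 10 ^ 16 := by
    rw [le_div_iff₀ (by norm_num : (0:ℝ) < 10 ^ 16)]
    nlinarith
  have hεcn : cn * ε ≤ 1 / 10 ^ 16 := by
    rw [le_div_iff₀ (by norm_num : (0:ℝ) < 10 ^ 16)]
    nlinarith [mul_le_mul_of_nonneg_right hcnc hε.le]
  set η : ℝ := ε / M ^ 2 with hηdef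
  have hη0 : 0 < η := by positivity
  have hηε : η ≤ ε := by rw [hηdef]; exact div_le_self hε.le (one_le_pow₀ hM)
  have hXη : X * η ≤ 45 * ε / M := by
    calc X * η ≤ 45 * M * η := mul_le_mul_of_nonneg_right hX hη0.le
      _ = 45 * ε / M := by rw [hηdef]; field_simp
  have hX₂η : X₂ * η ≤ 45 * ε / M := by
    calc X₂ * η ≤ 45 * M * η := mul_le_mul_of_nonneg_right hX₂ hη0.le
      _ = 45 * ε / M := by rw [hηdef]; field_simp
  have hεM : ε / M ≤ ε := div_le_self hε.le hM
  have hX2η : X ^ 2 * η ≤ 2025 * ε := by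
    calc X ^ 2 * η ≤ (45 * M) ^ 2 * η := mul_le_mul_of_nonneg_right (pow_le_pow_left₀ (by linarith) hX 2) hη0.le
      _ = 2025 * ε := by rw [hηdef]; field_simp; ring
  refine ⟨?_, ?_, ?_, ?_⟩
  · -- (c1): `b₀ ≤ 270 ε/M ≤ 270 ε`, `4b₀ ≤ 1`, `8b₀(e^{4b₀}−1) ≤ 64b₀² ≤ η`
    set b₀ : ℝ := Real.pi / 2 * (3 * X₂ * η) with hb₀
    have hb₀0 : 0 ≤ b₀ := by positivity
    have hpi : Real.pi / 2 ≤ 2 := by linarith [Real.pi_le_four]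
    have hb₀le : b₀ ≤ 270 * ε / M := by
      calc b₀ ≤ 2 * (3 * X₂ * η) := mul_le_mul_of_nonneg_right hpi (by positivity)
        _ = 6 * (X₂ * η) := by ring
        _ ≤ 6 * (45 * ε / M) := by linarith
        _ = 270 * ε / M := by ring
    have hb₀le' : b₀ ≤ 270 * ε := hb₀le.trans (by
      have := mul_le_mul_of_nonneg_left hεM (by norm_num : (0:ℝ) ≤ 270)
      linarith [show 270 * ε / M = 270 * (ε / M) by ring])
    have h4b : 4 * b₀ ≤ 1 := by nlinarith
    have hexp : Real.exp (4 * b₀) - 1 ≤ 2 * (4 * b₀) := exp_sub_one_le _ (by positivity) h4b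
    have hsq : 8 * b₀ * (Real.exp (4 * b₀) - 1) ≤ 64 * b₀ ^ 2 := by nlinarith
    have hb₀sq : 64 * b₀ ^ 2 ≤ η := by
      have h1 : b₀ ^ 2 ≤ (270 * ε / M) ^ 2 := pow_le_pow_left₀ hb₀0 hb₀le 2
      have h2 : 64 * (270 * ε / M) ^ 2 = (4665600 * ε) * (ε / M ^ 2) := by field_simp; ring
      have h3 : (4665600 * ε) * (ε / M ^ 2) ≤ 1 * (ε / M ^ 2) := mul_le_mul_of_nonneg_right (by nlinarith) hη0.le
      rw [hηdef]; linarith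
    linarith
  · -- (c2)
    push_cast
    have : 576 * (64 * (4 : ℝ) ^ 3 * X) ^ 2 * (2 * η) = 19327352832 * (X ^ 2 * η) := by ring
    rw [this]; nlinarith
  · -- (c3)
    push_cast
    have h1 : (1 + 2 * (4 : ℝ) * X) ≤ 9 * X := by linarith
    have h2 : cn * (1 + 2 * (4 : ℝ) * X) * (256 * (4 : ℝ) ^ 3 * X * (2 * η)) ≤ cn * (9 * X) * (256 * (4 : ℝ) ^ 3 * X * (2 * η)) :=
      mul_le_mul_of_nonneg_right (mul_le_mul_of_nonneg_left h1 (by linarith)) (by positivity)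
    have h3 : cn * (9 * X) * (256 * (4 : ℝ) ^ 3 * X * (2 * η)) = 294912 * cn * (X ^ 2 * η) := by ring
    rw [h3] at h2
    have h4 : 294912 * cn * (X ^ 2 * η) ≤ 294912 * cn * (2025 * ε) := mul_le_mul_of_nonneg_left hX2η (by positivity)
    nlinarith
  · -- (c4)
    push_cast
    calc 128 * (4 : ℝ) ^ 3 * X * (2 * η) = 16384 * (X * η) := by ring
      _ ≤ 16384 * (45 * ε / M) := by linarith
      _ = 737280 * ε / M := by ring

/-- **THE RAW BOUNDS OF G3a ARE `O(ε∕M²)`, `O(ε∕M³)`.**  With `η = ε∕M²`, `a₀ ≤ 737280ε∕M` (`0 ≤ a₀`), `j = C_J ε∕M³`, under `10¹⁶·c·ε ≤ 1` with `C_J + 1 ≤ c`: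
`j_ε ≤ (C_J + 1)ε∕M³`, `G₁ ≤ K₂ε∕M²` (`K₂ = 6635520 + 64(C_J + 1)`), `Λ ≤ (C_J + 2)ε∕M³`, `144·4·a₀·(16M) ≤ 1`, `a₀ ≤ 1∕4`. [folklore] -/
theorem raw_bounds {M ε c CJ a₀ : ℝ} (hM : 1 ≤ M) (hε : 0 < ε) (hc : 1 ≤ c) (hCJ : 0 ≤ CJ) (hCJc : CJ + 1 ≤ c) (hsmall : 10 ^ 16 * c * ε ≤ 1)
    (ha₀0 : 0 ≤ a₀) (ha₀ : a₀ ≤ 737280 * ε / M) :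
    let η : ℝ := ε / M ^ 2
    let jε : ℝ := CJ * ε / M ^ 3 + 4 * (η * (Real.exp a₀ - 1) * (2 + (Real.exp a₀ - 1)) + 2 * η * η * (2 + η))
    let G₁ : ℝ := 36 * 4 * a₀ / (16 * M) + 4 * (16 * M) * jε
    jε ≤ (CJ + 1) * ε / M ^ 3 ∧ G₁ ≤ (6635520 + 64 * (CJ + 1)) * ε / M ^ 2 ∧
    jε + (4 * 4 * (Real.exp (4 * a₀) - 1) + 2 * 4 * (Real.exp a₀ - 1)) * G₁ ≤ (CJ + 2) * ε / M ^ 3 ∧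
    144 * 4 * a₀ * (16 * M) ≤ 1 ∧ a₀ ≤ 1 / 4 := by
  intro η jε G₁
  have hM0 : 0 < M := by linarith
  have hM3 : 0 < M ^ 3 := by positivity
  have hεsmall : 10 ^ 16 * ε ≤ 1 := by nlinarith
  have hεCJ : 10 ^ 16 * (CJ + 1) * ε ≤ 1 := by nlinarith [mul_le_mul_of_nonneg_right hCJc hε.le]
  have ha₀ε : a₀ ≤ 737280 * ε := ha₀.trans (by
    have : 737280 * ε / M ≤ 737280 * ε / 1 := div_le_div_of_nonneg_left (by positivity) one_pos hM
    rw [div_one] at this; exact this)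
  have ha₀1 : a₀ ≤ 1 := by nlinarith
  have ha₀4 : a₀ ≤ 1 / 4 := by nlinarith
  have he1 : Real.exp a₀ - 1 ≤ 2 * a₀ := exp_sub_one_le a₀ ha₀0 ha₀1
  have he4 : Real.exp (4 * a₀) - 1 ≤ 2 * (4 * a₀) := exp_sub_one_le _ (by positivity) (by linarith)
  have hb0 : 0 ≤ Real.exp a₀ - 1 := by linarith [Real.add_one_le_exp a₀]
  have hb4 : 0 ≤ Real.exp (4 * a₀) - 1 := by linarith [Real.add_one_le_exp (4 * a₀)]
  have hη0 : 0 < η := by positivity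
  have hη1 : η ≤ 1 := by
    have : η ≤ ε := div_le_self hε.le (one_le_pow₀ hM)
    nlinarith
  -- `jε ≤ (C_J+1)ε/M³`
  have hjε : jε ≤ (CJ + 1) * ε / M ^ 3 := by
    have t1 : η * (Real.exp a₀ - 1) * (2 + (Real.exp a₀ - 1)) ≤ η * (2 * a₀) * 3 := by
      have : 2 + (Real.exp a₀ - 1) ≤ 3 := by linarith
      calc η * (Real.exp a₀ - 1) * (2 + (Real.exp a₀ - 1)) ≤ η * (2 * a₀) * (2 + (Real.exp a₀ - 1)) :=
            mul_le_mul_of_nonneg_right (mul_le_mul_of_nonneg_left he1 hη0.le) (by linarith)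
        _ ≤ η * (2 * a₀) * 3 := mul_le_mul_of_nonneg_left this (by positivity)
    have t2 : 2 * η * η * (2 + η) ≤ 6 * η * η := by nlinarith [mul_nonneg (mul_nonneg hη0.le hη0.le) (sub_nonneg.2 hη1)]
    have t3 : η * a₀ ≤ 737280 * ε * (ε / M ^ 3) := by
      calc η * a₀ ≤ η * (737280 * ε / M) := mul_le_mul_of_nonneg_left ha₀ hη0.le
        _ = 737280 * ε * (ε / M ^ 3) := by show ε / M ^ 2 * (737280 * ε / M) = _; field_simp
    have t4 : η * η ≤ ε * (ε / M ^ 3) := by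
      have : η * η = ε * (ε / M ^ 4) := by show ε / M ^ 2 * (ε / M ^ 2) = _; field_simp
      rw [this]
      refine mul_le_mul_of_nonneg_left ?_ hε.le
      exact div_le_div_of_nonneg_left hε.le hM3 (pow_le_pow_right₀ hM (by norm_num))
    have t5 : 4 * (η * (Real.exp a₀ - 1) * (2 + (Real.exp a₀ - 1)) + 2 * η * η * (2 + η)) ≤ (17694720 * ε + 24 * ε) * (ε / M ^ 3) := by
      nlinarith
    have t6 : (17694720 * ε + 24 * ε) * (ε / M ^ 3) ≤ 1 * (ε / M ^ 3) := mul_le_mul_of_nonneg_right (by nlinarith) (by positivity)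
    have e : (CJ + 1) * ε / M ^ 3 = CJ * ε / M ^ 3 + 1 * (ε / M ^ 3) := by ring
    show CJ * ε / M ^ 3 + 4 * (η * (Real.exp a₀ - 1) * (2 + (Real.exp a₀ - 1)) + 2 * η * η * (2 + η)) ≤ (CJ + 1) * ε / M ^ 3
    rw [e]; linarith
  have hjε0 : 0 ≤ jε := by
    show 0 ≤ CJ * ε / M ^ 3 + 4 * (η * (Real.exp a₀ - 1) * (2 + (Real.exp a₀ - 1)) + 2 * η * η * (2 + η))
    positivity
  -- `G₁ ≤ K₂ ε/M²`
  have hG₁ : G₁ ≤ (6635520 + 64 * (CJ + 1)) * ε / M ^ 2 := by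
    have t1 : 36 * 4 * a₀ / (16 * M) = 9 * (a₀ / M) := by field_simp; ring
    have t2 : a₀ / M ≤ 737280 * ε / M ^ 2 := by
      rw [div_le_iff₀ hM0]
      calc a₀ ≤ 737280 * ε / M := ha₀
        _ = 737280 * ε / M ^ 2 * M := by field_simp
    have t3 : 4 * (16 * M) * jε ≤ 4 * (16 * M) * ((CJ + 1) * ε / M ^ 3) := mul_le_mul_of_nonneg_left hjε (by positivity)
    have t4 : 4 * (16 * M) * ((CJ + 1) * ε / M ^ 3) = 64 * (CJ + 1) * ε / M ^ 2 := by field_simp; ring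
    have e : (6635520 + 64 * (CJ + 1)) * ε / M ^ 2 = 9 * (737280 * ε / M ^ 2) + 64 * (CJ + 1) * ε / M ^ 2 := by ring
    show 36 * 4 * a₀ / (16 * M) + 4 * (16 * M) * jε ≤ (6635520 + 64 * (CJ + 1)) * ε / M ^ 2
    rw [t1, e]; linarith
  have hG₁0 : 0 ≤ G₁ := by show 0 ≤ 36 * 4 * a₀ / (16 * M) + 4 * (16 * M) * jε; positivity
  -- `Λ ≤ (C_J+2)ε/M³`
  have hθ : 4 * 4 * (Real.exp (4 * a₀) - 1) + 2 * 4 * (Real.exp a₀ - 1) ≤ 144 * a₀ := by nlinarith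
  have hK : (106168320 * (6635520 + 64 * (CJ + 1)) * ε) ≤ 1 := by nlinarith
  have hΛ : jε + (4 * 4 * (Real.exp (4 * a₀) - 1) + 2 * 4 * (Real.exp a₀ - 1)) * G₁ ≤ (CJ + 2) * ε / M ^ 3 := by
    have t1 : (4 * 4 * (Real.exp (4 * a₀) - 1) + 2 * 4 * (Real.exp a₀ - 1)) * G₁ ≤ 144 * a₀ * G₁ := mul_le_mul_of_nonneg_right hθ hG₁0
    have t2 : 144 * a₀ * G₁ ≤ 144 * (737280 * ε / M) * ((6635520 + 64 * (CJ + 1)) * ε / M ^ 2) :=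
      mul_le_mul (mul_le_mul_of_nonneg_left ha₀ (by norm_num)) hG₁ hG₁0 (by positivity)
    have t3 : 144 * (737280 * ε / M) * ((6635520 + 64 * (CJ + 1)) * ε / M ^ 2) = (106168320 * (6635520 + 64 * (CJ + 1)) * ε) * (ε / M ^ 3) := by
      field_simp; ring
    have t4 : (106168320 * (6635520 + 64 * (CJ + 1)) * ε) * (ε / M ^ 3) ≤ 1 * (ε / M ^ 3) :=
      mul_le_mul_of_nonneg_right hK (by positivity)
    have t5 : 144 * a₀ * G₁ ≤ 1 * (ε / M ^ 3) := by rw [t3] at t2; exact t2.trans t4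
    have e : (CJ + 2) * ε / M ^ 3 = (CJ + 1) * ε / M ^ 3 + 1 * (ε / M ^ 3) := by ring
    rw [e]; linarith
  have haM : a₀ * M ≤ 737280 * ε := (le_div_iff₀ hM0).1 ha₀
  have hreg : 144 * 4 * a₀ * (16 * M) ≤ 1 := by nlinarith
  exact ⟨hjε, hG₁, hΛ, hreg, ha₀4⟩

end Arith

/-! ## §2 The docking -/

section Dock

variable {n : Type} [Fintype n] [DecidableEq n] [Nonempty n]

open NE7LocalLandauLetters (near_mono near_trans near_sub_e)

/-- **[Balaban1985Variational] THM 1 (9)₁, (9)₂, (10), (9)₃^{β<1} FOR EVERY CONSTRAINED MINIMISER ON THE PHYSICAL UNIT CUBE ABOUT EVERY POINT, `k`-UNIFORMLY** — see the module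
docstring (`M = L^k`; the gauge `u` and the potential `A` are PRODUCED; `C₀, C₁, C₂, C₃` depend on `L` and `card n` only). [folklore] -/
theorem all_minimisers_cube_reg910 {L : ℕ} (hL : 2 ≤ L) :
    ∃ C₀ C₁ C₂ C₃ : ℝ, 0 ≤ C₀ ∧ 0 ≤ C₁ ∧ 0 ≤ C₂ ∧ 0 ≤ C₃ ∧ ∃ ε₀ : ℝ, 0 < ε₀ ∧ ∀ ε : ℝ, 0 < ε → ε ≤ ε₀ → ∀ (N : ℕ) [NeZero N], 1 ≤ N →
      ∃ δV : ℝ, 0 < δV ∧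
        ∀ V ∈ {V : Site 4 → Fin 4 → (Matrix n n ℂ)ˣ | IsUnitaryCfg V ∧ IsPeriodicCfg V (N : ℤ) ∧ SmallField V δV},
        ∀ (k : ℕ) (U : Site 4 → Fin 4 → (Matrix n n ℂ)ˣ), IsMinimiser 4 (sfClass 4 L N ε) L N k V U → ∀ z : Site 4,
        ∃ (u : Site 4 → (Matrix n n ℂ)ˣ) (A : Site 4 → Fin 4 → Matrix n n ℂ), (∀ x, u x ∈ unitaryUnits (Matrix n n ℂ)) ∧
          (∀ (x : Site 4) (κ : Fin 4), (∀ i, |x i - z i| ≤ ((16 * L ^ k + 5 : ℕ) : ℤ)) → gaugeAct u U x κ = expUnit (A x κ)) ∧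
          (∀ (x : Site 4) (κ : Fin 4), (∀ i, |x i - z i| ≤ ((16 * L ^ k + 5 : ℕ) : ℤ)) → A x κ ∈ skewAdjoint (Matrix n n ℂ)) ∧
          (∀ (x : Site 4) (κ : Fin 4), (∀ i, |x i - z i| ≤ ((16 * L ^ k + 5 : ℕ) : ℤ)) → ‖A x κ‖ ≤ C₀ * ε / (L : ℝ) ^ k) ∧
          (∀ x : Site 4, 2 * supNorm (x - z) ≤ 16 * L ^ k → ∀ κ τ : Fin 4, ‖A (x + e τ) κ - A x κ‖ ≤ C₁ * ε / ((L : ℝ) ^ k) ^ 2) ∧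
          (∀ y : Site 4, supNorm (y - z) ≤ 7 * L ^ k → ∀ ν : Fin 4,
            ‖∑ i, ((A (y + e i) ν - A y ν) - (A y ν - A (y - e i) ν))‖ ≤ C₂ * ε / ((L : ℝ) ^ k) ^ 3) ∧
          (∀ β : ℝ, 0 ≤ β → β < 1 → ∀ z₁ z₂ : Site 4, z₁ ∈ cube z (L ^ k - 1) → z₂ ∈ cube z (L ^ k - 1) → ∀ μ κ : Fin 4,
            ‖(A (z₁ + e μ) κ - A z₁ κ) - (A (z₂ + e μ) κ - A z₂ κ)‖
              ≤ C₃ * (1 + (1 - β)⁻¹) * ε * (supNorm (z₁ - z₂) : ℝ) ^ β / ((L : ℝ) ^ k) ^ (2 + β)) := by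
  obtain ⟨C, hC, hG3a⟩ := cube_landau_reg910 (d := 4) (n := n) (by norm_num)
  obtain ⟨CJ, hCJ, ε₁, hε₁, H⟩ := all_minimisers_regularSpace_generic (n := n) hL
  set cn : ℝ := (Fintype.card n : ℝ) with hcn
  have hcn1 : 1 ≤ cn := by rw [hcn]; exact_mod_cast Fintype.card_pos
  set c : ℝ := (cn + 1) * (CJ + 1) with hcdef
  have hc1 : 1 ≤ c := by rw [hcdef]; nlinarith
  have hcnc : cn ≤ c := by rw [hcdef]; nlinarith
  have hCJc : CJ + 1 ≤ c := by rw [hcdef]; nlinarith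
  have hc0 : 0 < c := by linarith
  refine ⟨737280, 6635520 + 64 * (CJ + 1), CJ + 2, 3 * C * (CJ + 2 + 737280), by norm_num, by positivity, by positivity, by positivity,
    min ε₁ (1 / (10 ^ 16 * c)), lt_min hε₁ (by positivity), fun ε hε hεle N _ hN => ?_⟩
  have hεε₁ : ε ≤ ε₁ := hεle.trans (min_le_left _ _)
  have hsmall : 10 ^ 16 * c * ε ≤ 1 := by
    have h1 : ε ≤ 1 / (10 ^ 16 * c) := hεle.trans (min_le_right _ _)
    rw [le_div_iff₀ (by positivity)] at h1
    linarith
  obtain ⟨δV, hδV, HV⟩ := H ε hε hεε₁ N hN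
  refine ⟨δV, hδV, fun V hV k U hmin z => ?_⟩
  obtain ⟨hSF, hcov⟩ := HV V hV k U hmin
  have hcls : U ∈ sfClass 4 L N ε k := hmin.mem.1
  simp only [sfClass, Set.mem_setOf_eq] at hcls
  obtain ⟨hU, -, -⟩ := hcls
  -- scales
  have hL1 : (1 : ℝ) ≤ L := by exact_mod_cast (by omega : 1 ≤ L)
  have hMr1 : (1 : ℝ) ≤ (L : ℝ) ^ k := one_le_pow₀ hL1
  have hMr0 : (0 : ℝ) < (L : ℝ) ^ k := by positivity
  have hMn1 : 1 ≤ L ^ k := Nat.one_le_pow _ _ (by omega)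
  have hMcast : ((L ^ k : ℕ) : ℝ) = (L : ℝ) ^ k := by push_cast; ring
  set R : ℕ := 16 * L ^ k + 5 with hRdef
  have hη : 0 < ε / ((L : ℝ) ^ k) ^ 2 := by positivity
  -- the chart regime
  have hX : ((2 * R + 2 + 1 : ℕ) : ℝ) ≤ 45 * (L : ℝ) ^ k := by
    rw [hRdef]; push_cast; nlinarith
  have hX1 : (1 : ℝ) ≤ ((2 * R + 2 + 1 : ℕ) : ℝ) := by exact_mod_cast (by omega : 1 ≤ 2 * R + 2 + 1)
  have hX₂ : ((2 * R + 2 : ℕ) : ℝ) ≤ 45 * (L : ℝ) ^ k := by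
    rw [hRdef]; push_cast; nlinarith
  have hX₂0 : (0 : ℝ) ≤ ((2 * R + 2 : ℕ) : ℝ) := Nat.cast_nonneg _
  obtain ⟨hc1', hc2', hc3', hc4'⟩ := regime_chart (M := (L : ℝ) ^ k) hMr1 hε hc1 hcn1 hcnc hsmall hX hX1 hX₂ hX₂0
  -- the one-scale Uhlenbeck chart (gen 93)
  obtain ⟨u, A, hu, hexp, hskew, hAle, hLan⟩ := cube_landau_chart hU hη hSF R z hc1' hc2' (by rw [hcn] at hc3'; exact hc3')
  -- the sup currency
  set a₀ : ℝ := 737280 * ε / (L : ℝ) ^ k with ha₀def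
  have ha₀0 : 0 ≤ a₀ := by positivity
  have hA_a₀ : ∀ (x : Site 4) (κ : Fin 4), (∀ i, |x i - z i| ≤ (R : ℤ)) → ‖A x κ‖ ≤ a₀ := fun x κ hx => (hAle x κ hx).trans hc4'
  obtain ⟨hjεb, hG₁b, hΛb, hregb, ha₀4⟩ := raw_bounds (M := (L : ℝ) ^ k) (CJ := CJ) hMr1 hε hc1 hCJ hCJc hsmall ha₀0 le_rfl
  -- the gauged configuration `U^{u}`
  have hWε : SmallField (gaugeAct u U) (ε / ((L : ℝ) ^ k) ^ 2) := smallField_gaugeAct hu hSF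
  have hcovW : ∀ (ν : Fin 4) (y : Site 4), ‖covDiv 1 (gaugeAct u U) ν y‖ ≤ CJ * ε / ((L : ℝ) ^ k) ^ 3 := fun ν y => by
    rw [norm_covDiv_gaugeAct 1 (fun y => mem_U1_of_unitary (hu y)) U ν y]; exact hcov ν y
  -- the cube of radius `S = 16M + 4` and its relation to the chart cube of radius `R = 16M + 5`
  set S : ℤ := ((16 * L ^ k + 4 : ℕ) : ℤ) with hSdef
  have hSR : ∀ y : Site 4, (∀ i, |y i - z i| ≤ S) → ∀ i, |y i - z i| ≤ (R : ℤ) := fun y hy => near_mono hy (by rw [hSdef, hRdef]; push_cast; omega)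
  have hSR' : ∀ y : Site 4, (∀ i, |y i - z i| ≤ S) → ∀ κ : Fin 4, ∀ i, |(y - e κ) i - z i| ≤ (R : ℤ) := fun y hy κ =>
    near_mono (near_trans (near_sub_e y κ) hy) (by rw [hSdef, hRdef]; push_cast; omega)
  have hWexp : ∀ y : Site 4, (∀ i, |y i - z i| ≤ S) → ∀ κ : Fin 4, gaugeAct u U y κ = expUnit (A y κ) := fun y hy κ => hexp y κ (hSR y hy)
  have hAS : ∀ y : Site 4, (∀ i, |y i - z i| ≤ S) → ∀ κ : Fin 4, ‖A y κ‖ ≤ a₀ := fun y hy κ => hA_a₀ y κ (hSR y hy)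
  -- the `sinh`-Landau condition on the cube of radius `S`
  have hH : ∀ (y : Site 4) (κ : Fin 4), (∀ i, |y i - z i| ≤ (R : ℤ)) → (exp (A y κ))ᴴ = exp (-A y κ) := fun y κ hy => by
    have hsk : (A y κ)ᴴ = -A y κ := by rw [← Matrix.star_eq_conjTranspose]; exact skewAdjoint.mem_iff.mp (hskew y κ hy)
    rw [← Matrix.exp_conjTranspose, hsk]
  have hEL : ∀ y : Site 4, (∀ i, |y i - z i| ≤ S) →
      ∑ κ : Fin 4, (((2 : ℂ)⁻¹ • (exp (A y κ) - exp (-A y κ))) - ((2 : ℂ)⁻¹ • (exp (A (y - e κ) κ) - exp (-A (y - e κ) κ)))) = 0 := by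
    intro y hy
    have h := hLan y (hSR y hy)
    have hterm : ∀ κ : Fin 4, ((((gaugeAct u U y κ : (Matrix n n ℂ)ˣ) : Matrix n n ℂ) - ((gaugeAct u U y κ : (Matrix n n ℂ)ˣ) : Matrix n n ℂ)ᴴ)
          - (((gaugeAct u U (y - e κ) κ : (Matrix n n ℂ)ˣ) : Matrix n n ℂ) - ((gaugeAct u U (y - e κ) κ : (Matrix n n ℂ)ˣ) : Matrix n n ℂ)ᴴ))
        = (exp (A y κ) - exp (-A y κ)) - (exp (A (y - e κ) κ) - exp (-A (y - e κ) κ)) := by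
      intro κ
      have e1 : ((gaugeAct u U y κ : (Matrix n n ℂ)ˣ) : Matrix n n ℂ) = exp (A y κ) := by rw [hexp y κ (hSR y hy), val_expUnit]
      have e2 : ((gaugeAct u U (y - e κ) κ : (Matrix n n ℂ)ˣ) : Matrix n n ℂ) = exp (A (y - e κ) κ) := by rw [hexp (y - e κ) κ (hSR' y hy κ), val_expUnit]
      rw [e1, e2, hH y κ (hSR y hy), hH (y - e κ) κ (hSR' y hy κ)]
    rw [Finset.sum_congr rfl (fun κ _ => hterm κ)] at h
    simp_rw [← smul_sub]
    rw [← Finset.smul_sum, h, smul_zero]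
  -- G3a at `R₀ = 16M`
  have hR₀2 : 2 ≤ 16 * L ^ k := by omega
  have hR₀S : ((16 * L ^ k : ℕ) : ℤ) + 4 ≤ S := by rw [hSdef]; push_cast; omega
  have hR₀cast : ((16 * L ^ k : ℕ) : ℝ) = 16 * (L : ℝ) ^ k := by push_cast; ring
  have hreg : 144 * ((4 : ℕ) : ℝ) * a₀ * ((16 * L ^ k : ℕ) : ℝ) ≤ 1 := by rw [hR₀cast]; push_cast; linarith
  obtain ⟨h92, h10, h93⟩ := hG3a (gaugeAct u U) A z S (ε / ((L : ℝ) ^ k) ^ 2) a₀ (CJ * ε / ((L : ℝ) ^ k) ^ 3) hη.le ha₀0 ha₀4 (by positivity)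
    hWε hcovW hWexp hAS hEL (16 * L ^ k) hR₀2 hR₀S hreg
  refine ⟨u, A, hu, hexp, hskew, fun x κ hx => (hA_a₀ x κ hx).trans (le_of_eq (by rw [ha₀def])), ?_, ?_, ?_⟩
  · -- (9)₂
    intro x hx κ τ
    have h := h92 x hx κ τ
    rw [hR₀cast] at h
    push_cast at h
    exact h.trans hG₁b
  · -- (10) at `R₁ = 7M`
    intro y hy ν
    have h := h10 (7 * L ^ k) (by omega) y hy ν
    rw [hR₀cast] at h
    push_cast at h
    exact h.trans hΛb
  · -- (9)₃ at `m = M`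
    intro β hβ0 hβ1 z₁ z₂ hz₁ hz₂ μ κ
    have h := h93 (L ^ k) hMn1 (by omega) β hβ0 hβ1 z₁ z₂ hz₁ hz₂ μ κ
    rw [hR₀cast, hMcast] at h
    push_cast at h
    refine h.trans ?_
    have hε' : 0 < 1 - β := by linarith
    have hb : (0 : ℝ) ≤ 1 + (1 - β)⁻¹ := by positivity
    have hh : (0 : ℝ) ≤ (supNorm (z₁ - z₂) : ℝ) ^ β := Real.rpow_nonneg (by positivity) _
    have hsc := rpow_scaling (m := L ^ k) hMn1 hβ0
    rw [hMcast] at hsc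
    -- the bracket: `Λ + a₀/M² ≤ (C_J + 2 + 737280) ε / M³`
    have ha₀M : a₀ / ((L : ℝ) ^ k) ^ 2 = 737280 * ε / ((L : ℝ) ^ k) ^ 3 := by rw [ha₀def]; field_simp
    have hbr : (CJ * ε / ((L : ℝ) ^ k) ^ 3
          + 4 * (ε / ((L : ℝ) ^ k) ^ 2 * (Real.exp a₀ - 1) * (2 + (Real.exp a₀ - 1)) + 2 * (ε / ((L : ℝ) ^ k) ^ 2) * (ε / ((L : ℝ) ^ k) ^ 2) * (2 + ε / ((L : ℝ) ^ k) ^ 2))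
          + (4 * 4 * (Real.exp (4 * a₀) - 1) + 2 * 4 * (Real.exp a₀ - 1))
            * (36 * 4 * a₀ / (16 * (L : ℝ) ^ k) + 4 * (16 * (L : ℝ) ^ k) * (CJ * ε / ((L : ℝ) ^ k) ^ 3
              + 4 * (ε / ((L : ℝ) ^ k) ^ 2 * (Real.exp a₀ - 1) * (2 + (Real.exp a₀ - 1)) + 2 * (ε / ((L : ℝ) ^ k) ^ 2) * (ε / ((L : ℝ) ^ k) ^ 2) * (2 + ε / ((L : ℝ) ^ k) ^ 2))))
          + a₀ / ((L : ℝ) ^ k) ^ 2)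
        ≤ (CJ + 2 + 737280) * ε / ((L : ℝ) ^ k) ^ 3 := by
      rw [ha₀M]
      have e : (CJ + 2 + 737280) * ε / ((L : ℝ) ^ k) ^ 3 = (CJ + 2) * ε / ((L : ℝ) ^ k) ^ 3 + 737280 * ε / ((L : ℝ) ^ k) ^ 3 := by ring
      rw [e]; linarith
    have hbr0 : 0 ≤ (CJ + 2 + 737280) * ε / ((L : ℝ) ^ k) ^ 3 := by positivity
    have hK : 0 ≤ C * (1 + (1 - β)⁻¹) := by positivity
    calc C * (1 + (1 - β)⁻¹)
          * ((CJ * ε / ((L : ℝ) ^ k) ^ 3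
              + 4 * (ε / ((L : ℝ) ^ k) ^ 2 * (Real.exp a₀ - 1) * (2 + (Real.exp a₀ - 1)) + 2 * (ε / ((L : ℝ) ^ k) ^ 2) * (ε / ((L : ℝ) ^ k) ^ 2) * (2 + ε / ((L : ℝ) ^ k) ^ 2))
              + (4 * 4 * (Real.exp (4 * a₀) - 1) + 2 * 4 * (Real.exp a₀ - 1))
                * (36 * 4 * a₀ / (16 * (L : ℝ) ^ k) + 4 * (16 * (L : ℝ) ^ k) * (CJ * ε / ((L : ℝ) ^ k) ^ 3
                  + 4 * (ε / ((L : ℝ) ^ k) ^ 2 * (Real.exp a₀ - 1) * (2 + (Real.exp a₀ - 1)) + 2 * (ε / ((L : ℝ) ^ k) ^ 2) * (ε / ((L : ℝ) ^ k) ^ 2) * (2 + ε / ((L : ℝ) ^ k) ^ 2))))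
              + a₀ / ((L : ℝ) ^ k) ^ 2))
          * (3 * (L : ℝ) ^ k) ^ (1 - β) * (supNorm (z₁ - z₂) : ℝ) ^ β
        ≤ C * (1 + (1 - β)⁻¹) * ((CJ + 2 + 737280) * ε / ((L : ℝ) ^ k) ^ 3) * (3 * (L : ℝ) ^ k) ^ (1 - β) * (supNorm (z₁ - z₂) : ℝ) ^ β := by
          apply mul_le_mul_of_nonneg_right _ hh
          apply mul_le_mul_of_nonneg_right _ (Real.rpow_nonneg (by positivity) _)
          exact mul_le_mul_of_nonneg_left hbr hK
      _ = C * (1 + (1 - β)⁻¹) * ((CJ + 2 + 737280) * ε) * ((3 * (L : ℝ) ^ k) ^ (1 - β) / ((L : ℝ) ^ k) ^ 3) * (supNorm (z₁ - z₂) : ℝ) ^ β := by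
          ring
      _ ≤ C * (1 + (1 - β)⁻¹) * ((CJ + 2 + 737280) * ε) * (3 / ((L : ℝ) ^ k) ^ (2 + β)) * (supNorm (z₁ - z₂) : ℝ) ^ β := by
          apply mul_le_mul_of_nonneg_right _ hh
          exact mul_le_mul_of_nonneg_left hsc (by positivity)
      _ = 3 * C * (CJ + 2 + 737280) * (1 + (1 - β)⁻¹) * ε * (supNorm (z₁ - z₂) : ℝ) ^ β / ((L : ℝ) ^ k) ^ (2 + β) := by ring

end Dock

end

end Summit.QuantumFields.BalabanUV.T4Continuum.NE7AllMinimisersCubeReg910
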